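import Summits.Schanuel.Schanuel.Theorems.RootDecomp1DFlagSplit
import Literature.NumberTheory.Transcendental.LindemannWeierstrassProofs

/-!
# RootDecomp1J — the Hermite–Lindemann faces of K₁ = `CurvePointsOverExpLogFields` (lens-3 g21, node v11 §20–§21)

Port (`--supports stmt-Schanuel-29587`) of the §20 «faces» block and the §21 BC5 glue of the lens-3 node
file `HOME/decomp-schanuel-lens-3/v11/PeriodFlagSplit.lean`, cited by name in the docstring of the crux
K₁ = `Rel(𝓚|𝓜)` = `CurvePointsOverExpLogFields` (stmt-Schanuel-29587 of route-Schanuel-RootDecomp1J):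

* `relOn_face_empty_one` — the `(∅; g)`-face of EVERY relative sector `Rel(E'|E)` is a theorem
  (Hermite–Lindemann, tree `transcendental_exp_holds`): a single `g` free modulo `E` is `≠ 0`, so
  `trdeg_{ℚ(∅)} ℚ(∅)(g, e^g) ≥ 1`. Instances: the K₁-cells `((∅); (ζ))` for a fixed point `ζ = e^ζ` and
  `((∅); (Ω))`, the K₂/K₃-cells `((∅); (x))`;
* `mem_curveHull_of_exp_eq_self` — every fixed point `ζ = e^ζ` lies in the FIRST curve step over any
  `ℚ`-subspace `M`, hence in the curve hull `⋃ₙ (M^C)^[n+1]` written exactly as in the item (witness set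
  `Y = ∅`: `(ζ, e^ζ) = (ζ, ζ)` lies on the line `y = x`), so fixed points are K₁-coordinates;
* the flagship data: `ne_zero_of_exp_eq_self`, (fixed points are transcendental: tree `RootDecomp1SharedDegree.transcendental_of_fixedPoint`, not restated here),
  `transcendental_of_mul_exp_eq_one` (fixed points and `Ω`-points are transcendental — all that is known);
* `relOn_face_empty_of_abs` — an absolute count `trdeg_ℚ ℚ(z, e^z) ≥ m` IS the `(∅; z)`-cell count (the
  glue by which the BC5 plan-only rung «two fixed points of `exp` are algebraically independent» becomes
  the `(∅; ζ₀, ζ₁)` cell of K₁, `relOn_face_empty_of_abs_args`).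

Defines nothing; tools `RootDecomp1DFlagSplit.{trdeg_adjoin_le_cardinalMk, trdeg_gens_lt_aleph0, rel_iff_add}`.
0 sorry. [cite: Waldschmidt2000, §1.4 (Hermite–Lindemann)] [cite: Kirby2010, §3] [cite: Marker2006]
-/

noncomputable section

open Complex IntermediateField

namespace Summit.Schanuel.Schanuel.Theorems.RootDecomp1JCurveFaces

open Summit.Schanuel.Schanuel.Theorems.RootDecomp1DFlagSplit (trdeg_adjoin_le_cardinalMk
  trdeg_gens_lt_aleph0 rel_iff_add)
open Literature.NumberTheory.Transcendental (transcendental_exp_holds)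

/-- Monotonicity of `trdeg` along an inclusion of intermediate fields. [folklore] -/
private theorem trdeg_mono {F E : Type*} [Field F] [Field E] [Algebra F E]
    {L L' : IntermediateField F E} (h : L ≤ L') : Algebra.trdeg F L ≤ Algebra.trdeg F L' :=
  trdeg_le_of_injective (IntermediateField.inclusion h) (IntermediateField.inclusion_injective h)

/-! ### §1 Hermite–Lindemann as a cost statement -/

/-- Hermite–Lindemann as a cost statement: for `ζ ≠ 0`, `trdeg ℚ(ζ, e^ζ) ≥ 1`. -/
theorem one_le_trdeg_pair_of_ne_zero {ζ : ℂ} (hζ : ζ ≠ 0) :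
    (1 : Cardinal) ≤ Algebra.trdeg ℚ ↥(adjoin ℚ ({ζ, cexp ζ} : Set ℂ)) := by
  set F := adjoin ℚ ({ζ, cexp ζ} : Set ℂ) with hF
  have hζF : ζ ∈ F := subset_adjoin ℚ _ (Set.mem_insert ζ _)
  have heF : cexp ζ ∈ F := subset_adjoin ℚ _ (Set.mem_insert_of_mem ζ (Set.mem_singleton _))
  obtain ⟨t, htF, ht⟩ : ∃ t : ℂ, t ∈ F ∧ Transcendental ℚ t := by
    by_cases hζa : IsAlgebraic ℚ ζ
    · exact ⟨cexp ζ, heF, transcendental_exp_holds hζa hζ⟩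
    · exact ⟨ζ, hζF, hζa⟩
  have h1 : AlgebraicIndependent ℚ fun _ : Fin 1 => t := algebraicIndependent_unique_type_iff.mpr ht
  let x' : Fin 1 → F := fun _ => ⟨t, htF⟩
  have hx' : AlgebraicIndependent ℚ x' := AlgebraicIndependent.of_comp F.val h1
  simpa using hx'.cardinalMk_le_trdeg

/-- A single `ζ ∉ E` is free modulo `E`. -/
theorem linearIndependent_mkQ_single {E : Submodule ℚ ℂ} {ζ : ℂ} (hζ : ζ ∉ E) :
    LinearIndependent ℚ (E.mkQ ∘ fun _ : Fin 1 => ζ) := by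
  have hne : E.mkQ ζ ≠ 0 := by
    rwa [Ne, Submodule.mkQ_apply, Submodule.Quotient.mk_eq_zero]
  refine Fintype.linearIndependent_iff.mpr fun g hg i => ?_
  have h0 : g 0 • E.mkQ ζ = 0 := by simpa using hg
  have h00 : g 0 = 0 := (smul_eq_zero.mp h0).resolve_right hne
  have hi : i = 0 := Subsingleton.elim _ _
  rw [hi]; exact h00

/-- An absolute count `trdeg_ℚ ℚ(z, e^z) ≥ m` is the `(∅; z)`-cell count of every relative sector
(base field `ℚ(∅) = ℚ`; tower law). [folklore] (private copy; the public theorem of record is `RootDecomp1JFlagCells.relOn_face_empty_of_abs`) -/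
private theorem relOn_face_empty_of_abs {m : ℕ} (y : Fin 0 → ℂ) (z : Fin m → ℂ)
    (habs : (m : Cardinal) ≤ Algebra.trdeg ℚ ↥(adjoin ℚ (Set.range z ∪ Set.range (cexp ∘ z)))) :
    (m : Cardinal) ≤ Algebra.trdeg ↥(adjoin ℚ (Set.range y ∪ Set.range (cexp ∘ y)))
      ↥(adjoin ↥(adjoin ℚ (Set.range y ∪ Set.range (cexp ∘ y)))
        (Set.range z ∪ Set.range (cexp ∘ z))) := by
  have hfin := trdeg_gens_lt_aleph0 y
  refine (rel_iff_add _ _ hfin m).2 ?_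
  have hG : Set.range y ∪ Set.range (cexp ∘ y) = ∅ := by simp [Set.range_eq_empty]
  have hbase : Algebra.trdeg ℚ ↥(adjoin ℚ (Set.range y ∪ Set.range (cexp ∘ y))) = 0 := by
    apply nonpos_iff_eq_zero.mp
    refine (trdeg_adjoin_le_cardinalMk _).trans ?_
    rw [hG]; simp
  rw [hbase, zero_add]
  have hsub : Set.range z ∪ Set.range (cexp ∘ z) ⊆
      (Set.range y ∪ Set.range (cexp ∘ y)) ∪ (Set.range z ∪ Set.range (cexp ∘ z)) :=
    fun t ht => Or.inr ht
  exact habs.trans (trdeg_mono (adjoin.mono _ _ _ hsub))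

/-- The same with a count on the ARGUMENTS alone: `trdeg_ℚ ℚ(z) ≥ m` gives the `(∅; z)`-cell count (the
BC5 rung «two fixed points `ζ₀ ≠ ζ₁` of `exp` have `trdeg ℚ(ζ₀, ζ₁) = 2`» is thereby the `(∅; ζ₀, ζ₁)`
cell of K₁). -/
theorem relOn_face_empty_of_abs_args {m : ℕ} (y : Fin 0 → ℂ) (z : Fin m → ℂ)
    (habs : (m : Cardinal) ≤ Algebra.trdeg ℚ ↥(adjoin ℚ (Set.range z))) :
    (m : Cardinal) ≤ Algebra.trdeg ↥(adjoin ℚ (Set.range y ∪ Set.range (cexp ∘ y)))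
      ↥(adjoin ↥(adjoin ℚ (Set.range y ∪ Set.range (cexp ∘ y)))
        (Set.range z ∪ Set.range (cexp ∘ z))) :=
  relOn_face_empty_of_abs y z (habs.trans (trdeg_mono (adjoin.mono _ _ _ Set.subset_union_left)))

/-- **The `(∅; g)`-face of EVERY sector `Rel(E'|E)` is a theorem** (Hermite–Lindemann): a single `g` free
modulo `E` is `≠ 0`, so `trdeg_ℚ ℚ(g, e^g) ≥ 1` over the base field `ℚ(∅)`. Instances: the K₁-cells
`((∅); (ζ))` for a fixed point `ζ = e^ζ ∉ 𝓜` and `((∅); (Ω))`; the K₂/K₃-cells `((∅); (x))`, `x ∉ 𝓚`. -/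
theorem relOn_face_empty_one (E : Submodule ℚ ℂ) (y : Fin 0 → ℂ) (z : Fin 1 → ℂ)
    (hz : LinearIndependent ℚ (E.mkQ ∘ z)) :
    ((1 : ℕ) : Cardinal) ≤ Algebra.trdeg ↥(adjoin ℚ (Set.range y ∪ Set.range (cexp ∘ y)))
      ↥(adjoin ↥(adjoin ℚ (Set.range y ∪ Set.range (cexp ∘ y)))
        (Set.range z ∪ Set.range (cexp ∘ z))) := by
  have hz0 : z 0 ≠ 0 := by
    intro h0
    apply hz.ne_zero 0
    show E.mkQ (z 0) = 0
    rw [h0, map_zero]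
  refine relOn_face_empty_of_abs y z ?_
  have hsub : ({z 0, cexp (z 0)} : Set ℂ) ⊆ Set.range z ∪ Set.range (cexp ∘ z) := by
    rintro t (rfl | ht)
    · exact Or.inl ⟨0, rfl⟩
    · rw [Set.mem_singleton_iff.mp ht]; exact Or.inr ⟨0, rfl⟩
  push_cast
  exact (one_le_trdeg_pair_of_ne_zero hz0).trans (trdeg_mono (adjoin.mono _ _ _ hsub))

/-- The `(∅; ζ)`-cell for any `ζ ∉ E`, e.g. a fixed point of `exp` or `Ω`, granted `∉ E`. -/
theorem relOn_cell_empty_one_of_not_mem (E : Submodule ℚ ℂ) {ζ : ℂ} (hζ : ζ ∉ E) :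
    ((1 : ℕ) : Cardinal) ≤ Algebra.trdeg
      ↥(adjoin ℚ (Set.range (fun i : Fin 0 => i.elim0) ∪ Set.range (cexp ∘ fun i : Fin 0 => i.elim0)))
      ↥(adjoin ↥(adjoin ℚ (Set.range (fun i : Fin 0 => i.elim0) ∪
          Set.range (cexp ∘ fun i : Fin 0 => i.elim0)))
        (Set.range (fun _ : Fin 1 => ζ) ∪ Set.range (cexp ∘ fun _ : Fin 1 => ζ))) :=
  relOn_face_empty_one E _ _ (linearIndependent_mkQ_single hζ)

/-! ### §2 Fixed points and `Ω`-points: transcendence (Hermite–Lindemann) and hull membership -/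

/-- Fixed points of `exp` are nonzero. -/
theorem ne_zero_of_exp_eq_self {ζ : ℂ} (h : cexp ζ = ζ) : ζ ≠ 0 := by
  rintro rfl; simp at h

/-- `Ω`-points (`g e^g = 1`) are transcendental (Hermite–Lindemann). -/
theorem transcendental_of_mul_exp_eq_one {g : ℂ} (h : g * cexp g = 1) : Transcendental ℚ g := by
  intro hg
  have hg0 : g ≠ 0 := by rintro rfl; simp at h
  have he : cexp g = g⁻¹ := (inv_eq_of_mul_eq_one_right h).symm
  exact transcendental_exp_holds hg hg0 (by rw [he]; exact hg.inv)

/-- Every fixed point `ζ = e^ζ` lies in the FIRST curve step `M ⊔ span_ℚ{curve points over M}` over any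
`ℚ`-subspace `M` (witness set `Y = ∅`: the pair `(ζ, e^ζ) = (ζ, ζ)` generates over `ℚ(∅)` a field of
transcendence degree `≤ 1`), hence in the curve hull `⋃ₙ (M^C)^[n+1]` — written exactly as the upper
space of K₁ = `CurvePointsOverExpLogFields` (stmt-Schanuel-29587) with `M` for its EL-span. -/
theorem mem_curveHull_of_exp_eq_self (M : Submodule ℚ ℂ) {ζ : ℂ} (h : cexp ζ = ζ) :
    ζ ∈ ⨆ n : ℕ, (fun E : Submodule ℚ ℂ => E ⊔ Submodule.span ℚ {g : ℂ | ∃ Y : Finset ℂ,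
      (↑Y : Set ℂ) ⊆ ↑E ∧ Algebra.trdeg ↥(IntermediateField.adjoin ℚ ((↑Y : Set ℂ) ∪ Complex.exp '' ↑Y))
        ↥(IntermediateField.adjoin ↥(IntermediateField.adjoin ℚ ((↑Y : Set ℂ) ∪ Complex.exp '' ↑Y))
          ({g, Complex.exp g} : Set ℂ)) ≤ 1})^[n + 1] M := by
  refine Submodule.mem_iSup_of_mem 0 ?_
  simp only [zero_add, Function.iterate_one]
  refine Submodule.mem_sup_right (Submodule.subset_span ⟨∅, by simp, ?_⟩)
  rw [h, Set.pair_eq_singleton]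
  exact (trdeg_adjoin_le_cardinalMk _).trans (Cardinal.mk_singleton _).le

end Summit.Schanuel.Schanuel.Theorems.RootDecomp1JCurveFaces

end
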